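import Summits.QuantumFields.YangMills.Theorems.SwapVirialDeficitBlowUpGnomonicLetterFloors
import Summits.QuantumFields.YangMills.Theorems.SwapVirialDeficitBlowUpGnomonicRelationQuaternions
import HarnessLib

/-!
# The four-letter leader floor at the TIP hub `hubAt δ 1` (every `δ`)

Sub-problem `SwapVirialDeficit`, crux ⟨stmt-QuantumFields-24197⟩ `SwapGluedStiffness`, skeleton ➎, stub `stub_core_tip`, socket (hCore)
(the law-free Laplace ceiling of the tip core).  This is the tip analogue of the end-core three-letter floor ✓`endGauss_three_floor` /
✓`endGauss_exp_three_floor`: at the hub `a = hubAt δ 1` (`re a = δ`, `‖im a‖ = 1`, `‖a‖² = 1 + δ²`, so `sin²ψ = s² := (1+δ²)⁻¹`) the four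
letter floors of ✓`SwapVirialDeficitBlowUpGnomonicLetterFloors` read, with `x = (x₀,u) = η.1.1`, `y = (y₀,v) = η.1.2`, `z = η.2.1`,

* (hub-polar, SOFT) `16δ²s⁴·|u|²/(1+|x|²) ≤ 7200L⁶F̂`,
* (y⊥, SOFT) `4s²·|v|²/(1+|y|²) ≤ 1800L⁶F̂`,
* (y₀∧u, STIFF, hub-free) `4|x₀v − y₀u|²/((1+|x|²)(1+|y|²)) ≤ 1800L⁶F̂`,
* (z, STIFF) `|z|²/(1+|z|²) ≤ 1800L⁶F̂`,

whence the sum floor `tip_four_floor` and its exponential form `tip_exp_four_floor` (any `c ≥ 0`, any followers, any signs, any `δ`).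
In the joint/relative letters `u = x₀τ − y₀ρ`, `v = y₀τ + x₀ρ` one has `x₀v − y₀u = (x₀² + y₀²)ρ` and `|u|² + |v|² = (x₀²+y₀²)(|τ|²+|ρ|²)`
(`tip_jointRel_letters`): the relative tilt `ρ` is stiff, the joint tilt `τ` carries the soft factor `s²`.

HONEST LABEL: helper inequalities only; (hCore), `stub_core_tip`, ⟨24197⟩, ⟨24194⟩ remain OPEN; nothing here proves the Yang–Mills mass gap.
-/

noncomputable section

open MeasureTheory Quaternion
open scoped BigOperators Quaternion
open Literature.MathematicalPhysics.QuantumFieldTheory hiding SU2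
open Literature.MathematicalPhysics.QuantumLattice

namespace Summit.QuantumFields.YangMills.Theorems.SwapVirialDeficit.BlowUpRing

open Summit.QuantumFields.YangMills.Theorems.FemtoTransferGap
open Summit.QuantumFields.YangMills.Theorems.FemtoTransferGap.TT
open Summit.QuantumFields.YangMills.Theorems.VirialFluxGap.RingDeficit
open Summit.QuantumFields.YangMills.Theorems.SwapVirialDeficit.SwapRing
open Summit.QuantumFields.YangMills.Theorems.SwapVirialDeficit.Gnomonic (normSq3)

variable {L : ℕ} [NeZero L]

omit [NeZero L] in
/-- The joint/relative letters: with `u = x₀τ − y₀ρ`, `v = y₀τ + x₀ρ` (componentwise), `x₀v − y₀u = (x₀²+y₀²)ρ` and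
`u² + v² = (x₀²+y₀²)(τ²+ρ²)`. [folklore] -/
theorem tip_jointRel_letters (x₀ y₀ τ ρ : ℝ) :
    x₀ * (y₀ * τ + x₀ * ρ) - y₀ * (x₀ * τ - y₀ * ρ) = (x₀ ^ 2 + y₀ ^ 2) * ρ ∧
      (x₀ * τ - y₀ * ρ) ^ 2 + (y₀ * τ + x₀ * ρ) ^ 2 = (x₀ ^ 2 + y₀ ^ 2) * (τ ^ 2 + ρ ^ 2) := by
  constructor <;> ring

/-- ★★ **THE FOUR-LETTER LEADER FLOOR AT THE TIP HUB** `hubAt δ 1` (every `δ`, every sign pattern, every letter, any followers):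
`4δ²s⁴|u|²/(1+|x|²) + 4s²|v|²/(1+|y|²) + 4|x₀v−y₀u|²/((1+|x|²)(1+|y|²)) + |z|²/(1+|z|²) ≤ 7200·L⁶·F̂(hubAt δ 1, ε, η)`, `s² = (1+δ²)⁻¹`.
[cite: Luscher1983, §2] -/
theorem tip_four_floor (δ : ℝ) (ε : GnoSign L) (η : GnoCoord L) :
    4 * δ ^ 2 * ((1 + δ ^ 2)⁻¹) ^ 2 * ((η.1.1 1) ^ 2 + (η.1.1 2) ^ 2) / (1 + ((η.1.1 0) ^ 2 + (η.1.1 1) ^ 2 + (η.1.1 2) ^ 2)) +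
          4 * (1 + δ ^ 2)⁻¹ * ((η.1.2 1) ^ 2 + (η.1.2 2) ^ 2) / (1 + ((η.1.2 0) ^ 2 + (η.1.2 1) ^ 2 + (η.1.2 2) ^ 2)) +
          4 * ((η.1.1 2 * η.1.2 0 - η.1.1 0 * η.1.2 2) ^ 2 + (η.1.1 0 * η.1.2 1 - η.1.1 1 * η.1.2 0) ^ 2) /
            ((1 + ((η.1.1 0) ^ 2 + (η.1.1 1) ^ 2 + (η.1.1 2) ^ 2)) * (1 + ((η.1.2 0) ^ 2 + (η.1.2 1) ^ 2 + (η.1.2 2) ^ 2))) +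
          ((η.2.1 0) ^ 2 + (η.2.1 1) ^ 2 + (η.2.1 2) ^ 2) / (1 + ((η.2.1 0) ^ 2 + (η.2.1 1) ^ 2 + (η.2.1 2) ^ 2)) ≤
      7200 * (L : ℝ) ^ 6 * gnoDeficit (fun _ => false) (fun _ => 1) (hubAt δ 1) ε η := by
  have ha : hubAt δ 1 ≠ 0 := hubAt_one_ne_zero δ
  have hP := gnoDeficit_floor_hubPolar (L := L) ha ε η
  have hY := gnoDeficit_floor_yPerp (L := L) ha ε η
  have hA := gnoDeficit_floor_yAxial (L := L) (hubAt δ 1) ε η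
  have hZ := gnoDeficit_floor_z (L := L) ha ε η
  obtain ⟨-, hre, -, hn2⟩ := bfar_hubAt_facts δ
  have him : ‖(hubAt δ 1).im‖ ^ 2 = 1 := by rw [norm_im_hubAt_one]; norm_num
  rw [hre, him, hn2] at hP
  rw [him, hn2] at hY
  -- letters
  set Sx : ℝ := (η.1.1 0) ^ 2 + (η.1.1 1) ^ 2 + (η.1.1 2) ^ 2 with hSx
  set Sy : ℝ := (η.1.2 0) ^ 2 + (η.1.2 1) ^ 2 + (η.1.2 2) ^ 2 with hSy
  set U : ℝ := (η.1.1 1) ^ 2 + (η.1.1 2) ^ 2 with hU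
  set Q : ℝ := (η.1.2 1) ^ 2 + (η.1.2 2) ^ 2 with hQ
  set F := gnoDeficit (fun _ => false) (fun _ => 1) (hubAt δ 1) ε η with hF
  have hSx0 : 0 < 1 + Sx := by rw [hSx]; positivity
  have hSy0 : 0 < 1 + Sy := by rw [hSy]; positivity
  have hd : 0 < 1 + δ ^ 2 := by positivity
  have e1 : 4 * δ ^ 2 * ((1 + δ ^ 2)⁻¹) ^ 2 * U / (1 + Sx) = (1 / 4) * (16 * δ ^ 2 * 1 * U / ((1 + δ ^ 2) ^ 2 * (1 + Sx))) := by
    field_simp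
    ring
  have e2 : 4 * (1 + δ ^ 2)⁻¹ * Q / (1 + Sy) = 4 * 1 * Q / ((1 + δ ^ 2) * (1 + Sy)) := by
    field_simp
  rw [e1, e2]
  linarith

/-- ★ **THE EXPONENTIAL FOUR-LETTER FLOOR AT THE TIP**: for `0 ≤ c`,
`e^{−(c·7200L⁶)·F̂(hubAt δ 1, ε, η)} ≤ e^{−c·4δ²s⁴|u|²/(1+|x|²)}·e^{−c·4s²|v|²/(1+|y|²)}·e^{−c·4|x₀v−y₀u|²/((1+|x|²)(1+|y|²))}·e^{−c|z|²/(1+|z|²)}`.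
[cite: Luscher1983, §2] -/
theorem tip_exp_four_floor (δ : ℝ) (ε : GnoSign L) (η : GnoCoord L) {c : ℝ} (hc : 0 ≤ c) :
    Real.exp (-(c * (7200 * (L : ℝ) ^ 6) * gnoDeficit (fun _ => false) (fun _ => 1) (hubAt δ 1) ε η)) ≤
      Real.exp (-(c * (4 * δ ^ 2 * ((1 + δ ^ 2)⁻¹) ^ 2 * ((η.1.1 1) ^ 2 + (η.1.1 2) ^ 2) / (1 + ((η.1.1 0) ^ 2 + (η.1.1 1) ^ 2 + (η.1.1 2) ^ 2))))) *
        Real.exp (-(c * (4 * (1 + δ ^ 2)⁻¹ * ((η.1.2 1) ^ 2 + (η.1.2 2) ^ 2) / (1 + ((η.1.2 0) ^ 2 + (η.1.2 1) ^ 2 + (η.1.2 2) ^ 2))))) *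
        Real.exp (-(c * (4 * ((η.1.1 2 * η.1.2 0 - η.1.1 0 * η.1.2 2) ^ 2 + (η.1.1 0 * η.1.2 1 - η.1.1 1 * η.1.2 0) ^ 2) /
          ((1 + ((η.1.1 0) ^ 2 + (η.1.1 1) ^ 2 + (η.1.1 2) ^ 2)) * (1 + ((η.1.2 0) ^ 2 + (η.1.2 1) ^ 2 + (η.1.2 2) ^ 2)))))) *
        Real.exp (-(c * (((η.2.1 0) ^ 2 + (η.2.1 1) ^ 2 + (η.2.1 2) ^ 2) / (1 + ((η.2.1 0) ^ 2 + (η.2.1 1) ^ 2 + (η.2.1 2) ^ 2))))) := by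
  have h := tip_four_floor (L := L) δ ε η
  rw [← Real.exp_add, ← Real.exp_add, ← Real.exp_add]
  refine Real.exp_le_exp.2 ?_
  have h' := mul_le_mul_of_nonneg_left h hc
  nlinarith [h']

end Summit.QuantumFields.YangMills.Theorems.SwapVirialDeficit.BlowUpRing

end
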